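import Literature.NumberTheory.Sieve.BombieriFriedlanderIwaniecPiForm
import Literature.NumberTheory.Sieve.BombieriFriedlanderIwaniecLeaves
import HarnessLib

/-!
# BFI Theorem 10, `π`-form: the DAG closed up to the printed deep theorems of the source

Topic `Literature/NumberTheory/Sieve`.  Everything here is PROVED.  This leaf file joins

* `Literature.NumberTheory.Sieve.BombieriFriedlanderIwaniecTheorem10Pi_of_theorem10`
  (`…PiForm`: Maynard's `π`-form restatement of Bombieri–Friedlander–Iwaniec, Acta Math. 156
  (1986), Theorem 10, from the theorem as printed there, the `ψ`-form), with
* `Literature.NumberTheory.Sieve.BombieriFriedlanderIwaniecTheorem10_of_leaves'` (`…Leaves`: the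
  printed Theorem 10 from the source's Theorems 0 (b), 1, 2, 5*, Lemma 3 and Shiu's Brun–Titchmarsh
  theorem for multiplicative functions, the Siegel–Walfisz theorem for `μ`, the fundamental lemma
  of the sieve and the prime number theorem being supplied by the tree).

Result: `Literature.NumberTheory.Sieve.BombieriFriedlanderIwaniecTheorem10Pi_of_leaves` — the
named fact `BombieriFriedlanderIwaniecTheorem10Pi` (Maynard, arXiv:2006.07088, p. 3, Theorem
(Bombieri, Friedlander, Iwaniec)) is CONDITIONAL exactly on the named facts
`BombieriFriedlanderIwaniecTheorem1`, `…Theorem2`, `…Theorem0b`, `…Theorem5StarInterval`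
(BFI 1986: Linnik's dispersion method, the Deshouillers–Iwaniec bounds for sums of Kloosterman
sums, the large sieve), `BombieriFriedlanderIwaniecLemma3` and `Shiu1980BrunTitchmarsh` (Shiu 1980,
Theorem 1) — the remaining unproved leaves of the DAG (D-0014), the same six as for the printed
`ψ`-form (`BombieriFriedlanderIwaniecTheorem10Pi_iff_theorem10`).

## References

* E. Bombieri, J. B. Friedlander, H. Iwaniec, *Primes in arithmetic progressions to large moduli*,
  Acta Math. 156 (1986), 203–251, Theorem 10 (p. 209) and §17. [BombieriFriedlanderIwaniecActa1986]
* J. Maynard, *Primes in arithmetic progressions to large moduli II: Well-factorable estimates*,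
  arXiv:2006.07088 (Mem. AMS 2025), p. 3, Theorem (Bombieri, Friedlander, Iwaniec).
  [Maynard2020LargeModuliII]
-/

namespace Literature.NumberTheory.Sieve

/-- **BFI Theorem 10, `π`-form (Maynard, arXiv:2006.07088, p. 3, Theorem (Bombieri–Friedlander–
Iwaniec)), from the six deep leaves**: Maynard's restatement follows from the source's Theorems 1,
2, 0 (b), 5* (on boxes), Lemma 3 and Shiu's theorem (named facts), through the printed `ψ`-form
(`BombieriFriedlanderIwaniecTheorem10_of_leaves'`) and the partial-summation passage
`BombieriFriedlanderIwaniecTheorem10Pi_of_theorem10`.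
[cite: Maynard2020LargeModuliII, p. 3, Theorem (Bombieri–Friedlander–Iwaniec)] -/
theorem BombieriFriedlanderIwaniecTheorem10Pi_of_leaves
    (h1 : BombieriFriedlanderIwaniecTheorem1) (h2 : BombieriFriedlanderIwaniecTheorem2)
    (h0b : BombieriFriedlanderIwaniecTheorem0b) (h5 : BombieriFriedlanderIwaniecTheorem5StarInterval)
    (hL3 : BombieriFriedlanderIwaniecLemma3) (hShiu : Shiu1980BrunTitchmarsh) :
    BombieriFriedlanderIwaniecTheorem10Pi :=
  BombieriFriedlanderIwaniecTheorem10Pi_of_theorem10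
    (BombieriFriedlanderIwaniecTheorem10_of_leaves' h1 h2 h0b h5 hL3 hShiu)

end Literature.NumberTheory.Sieve
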